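import Summits.AtomisticToContinuum.BoseEinsteinCondensation.Theorems.BECGroundStateSOSPeriodicIRBoundPFPositiveMain
import Summits.AtomisticToContinuum.BoseEinsteinCondensation.Theorems.BECGroundStateSOSPeriodicIRBoundPFOpNormGeneral
import Summits.AtomisticToContinuum.BoseEinsteinCondensation.Theorems.BECGroundStateSOSPeriodicIRBoundPFFormUpperBound2
import HarnessLib

/-!
# Crux `PeriodicIRBound` (stmt-AtomisticToContinuum-3972), line `linear-ph-floor-wagner` — the positivity KEY
# for a GENERAL measurable integrable profile (infinite range allowed)

Helper file of the line lead (seat c2), sequel of `…PFPositiveMain.lean` (the registered stub S-B for finite-range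
profiles) and `…PFOpNormGeneral.lean`. The proof of S-B used finite range only through the operator norm bound
`‖e^{-H_v}‖ ≤ e^{-E₀(v)}`; with `opNorm_pfkL2_le_exp_of_integrable` the same argument (Jensen for `L²(cell)`-limits
of `C¹` approximants, `inner_pfkL2_toLp_ge_exp_of_approx`; the Feynman–Kac eigen-equation; positivity of the
functional, `…PFPositive.lean`) gives **`ae_pos_of_nonneg_minimiser_of_integrable`**: for `N ≥ 1`, `L > 0`, a
MEASURABLE profile with `∫ v(|x|)dx < ∞`, every `L²(cell)`-normalised nonnegative measurable periodic `f`
approximated in `L²(cell)` by real periodic `C¹` functions of energy `→ ≤ E₀(v)` is a.e. strictly positive on the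
cell. The small-time form upper bound is supplied by the LANDED stub S-A (`stub_fkFormUpperBoundIntegrable`), so
this statement is unconditional (`ae_pos_of_nonneg_minimiser`).

References: Reed–Simon IV §XIII.12 Thms XIII.43–XIII.44; Faris–Simon, Duke Math. J. 42 (1975) 559.
-/

noncomputable section

open scoped BigOperators ENNReal NNReal InnerProductSpace Topology
open Filter MeasureTheory

namespace Summit.AtomisticToContinuum.BoseEinsteinCondensation.Cruxes.PeriodicIRBound.LinearPhFloorWagner

open Literature.MathematicalPhysics.QuantumManyBody
open Literature.MathematicalPhysics.QuantumManyBody.BoseGas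

variable {N : ℕ}

/-- **Positivity KEY for a general measurable integrable profile, given the form upper bound of stub S-A as a
hypothesis**: nonnegative `L²(cell)`-normalised periodic functions approximated by real periodic `C¹` functions of
energy `→ ≤ E₀(v)` are a.e. strictly positive (`N ≥ 1`, `L > 0`, `v` measurable with `∫ v(|x|)dx < ∞`).
[cite: ReedSimonIV1978, §XIII.12 Thm XIII.44] -/
theorem ae_pos_of_nonneg_minimiser_of_integrable :
    (∀ {N : ℕ} {L : ℝ}, 0 < L → ∀ {v : ℝ → ℝ≥0∞}, Measurable v →
      (∫⁻ X in cellN N L, periodicInteraction v L X) ≠ ⊤ →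
      ∀ {ψ : Config N → ℝ}, ContDiff ℝ 1 ψ →
        (∀ (X : Config N) (i : Fin N) (k : Fin 3), ψ (X + Pi.single i (EuclideanSpace.single k L)) = ψ X) →
        (∫⁻ X in cellN N L, ENNReal.ofReal (ψ X ^ 2) * periodicInteraction v L X) ≠ ⊤ →
        ∀ ε : ℝ, 0 < ε → ∃ t₀ : ℝ, 0 < t₀ ∧ ∀ t : ℝ≥0, t ≠ 0 → (t : ℝ) < t₀ →
          (∫ X in cellN N L, ψ X ^ 2) - ∫ X in cellN N L, ψ X * pfkReal v L t ψ X ≤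
            t * ((∫⁻ X in cellN N L, realKinetic ψ X).toReal +
              (∫⁻ X in cellN N L, ENNReal.ofReal (ψ X ^ 2) * periodicInteraction v L X).toReal + ε)) →
    ∀ {N : ℕ}, 1 ≤ N → ∀ {L : ℝ}, 0 < L → ∀ {v : ℝ → ℝ≥0∞}, Measurable v → (∫⁻ x : Space, v ‖x‖) ≠ ⊤ →
      ∀ f : Config N → ℝ, Measurable f → (∀ X, 0 ≤ f X) →
        (∀ (X : Config N) (i : Fin N) (k : Fin 3), f (X + Pi.single i (EuclideanSpace.single k L)) = f X) →
        (∫⁻ X in cellN N L, ENNReal.ofReal (f X ^ 2)) = 1 →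
        (∀ ε : ℝ, 0 < ε → ∃ φ : Config N → ℝ, ContDiff ℝ 1 φ ∧
          (∀ (X : Config N) (i : Fin N) (k : Fin 3), φ (X + Pi.single i (EuclideanSpace.single k L)) = φ X) ∧
          (∫⁻ X in cellN N L, ENNReal.ofReal ((φ X - f X) ^ 2)) ≤ ENNReal.ofReal ε ∧
          (∫⁻ X in cellN N L, realKinetic φ X) +
              (∫⁻ X in cellN N L, ENNReal.ofReal (φ X ^ 2) * periodicInteraction v L X) ≤
            periodicGroundStateEnergy v N L + ENNReal.ofReal ε) →
        ∀ᵐ X ∂(volume.restrict (cellN N L)), 0 < f X := by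
  intro hFUB N hN L hL v hv hint f hfm hf0 hfper hf1 happrox
  have hW := WF.lintegral_cellN_periodicInteraction_ne_top hL hv hint N
  have hE := periodicGroundStateEnergy_ne_top_of_integrable hv hN hL hW
  set μ : Measure (Config N) := volume.restrict (cellN N L) with hμ
  set c : ℝ := Real.exp (-((periodicGroundStateEnergy v N L).toReal * 1)) with hcdef
  have hc : 0 < c := Real.exp_pos _
  -- `f ∈ L²(cell)` with unit norm
  have hf2 : ∫⁻ Y in cellN N L, ‖f Y‖ₑ ^ (2 : ℝ) = 1 := by
    rw [← hf1]
    refine lintegral_congr fun Y => ?_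
    rw [Real.enorm_of_nonneg (hf0 Y), ENNReal.rpow_two, ← ENNReal.ofReal_pow (hf0 Y)]
  have hmem : MemLp f 2 μ := by
    refine ⟨hfm.aestronglyMeasurable, ?_⟩
    rw [hμ, eLpNorm_two_eq_cellN, hf2, ENNReal.one_rpow]
    exact ENNReal.one_lt_top
  set x : Lp ℝ 2 μ := hmem.toLp f with hxdef
  have hx1 : ‖x‖ = 1 := by
    rw [hxdef, Lp.norm_toLp, hμ, eLpNorm_two_eq_cellN, hf2, ENNReal.one_rpow, ENNReal.toReal_one]
  set T : Lp ℝ 2 μ →L[ℝ] Lp ℝ 2 μ := pfkL2 v L 1 with hTdef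
  -- (i) the operator norm and (ii) Jensen
  have hT : ‖T‖ ≤ c := opNorm_pfkL2_le_exp_of_integrable hv hint hN hL one_pos
  have hJ : c ≤ ⟪T x, x⟫_ℝ := by
    have h := inner_pfkL2_toLp_ge_exp_of_approx hFUB hL hv hW hE hfm hmem hx1 happrox one_pos
    rwa [← hcdef] at h
  -- (iii) the eigen-equation `T x = c • x`
  have heq : T x = c • x := by
    have hTx : ‖T x‖ ≤ c := (T.le_opNorm x).trans (by rw [hx1, mul_one]; exact hT)
    have h : ‖T x - c • x‖ ^ 2 ≤ 0 := by
      rw [@norm_sub_sq_real, inner_smul_right, norm_smul, Real.norm_eq_abs, abs_of_pos hc, hx1, mul_one]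
      nlinarith [hTx, hJ, norm_nonneg (T x)]
    have h0 : ‖T x - c • x‖ = 0 := by nlinarith [norm_nonneg (T x - c • x)]
    exact sub_eq_zero.1 (norm_eq_zero.1 h0)
  -- (iii') read on the cell: `pfkReal v L 1 f X = c * f X` a.e.
  have hae1 : ∀ᵐ X ∂μ, pfkReal v L 1 f X = c * f X := by
    have h1 := pfkL2_coeFn hv hL one_pos x
    have h2 : ((c • x : Lp ℝ 2 μ) : Config N → ℝ) =ᵐ[μ] c • (x : Config N → ℝ) := Lp.coeFn_smul c x
    have h3 : (x : Config N → ℝ) =ᵐ[μ] f := hmem.coeFn_toLp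
    rw [← hTdef, heq] at h1
    filter_upwards [h1, h2, h3] with X hX1 hX2 hX3
    rw [pfkReal_comp_cellProj_congr_ae v hL one_pos h3 X, comp_cellProj_eq_self hfper] at hX1
    rw [← hX1, hX2, Pi.smul_apply, smul_eq_mul, hX3]
  -- (iv) positivity of the left side a.e.
  have hne : ¬ f =ᵐ[μ] 0 := fun h0 => by
    have h : ∫⁻ X in cellN N L, ENNReal.ofReal (f X ^ 2) = 0 := by
      refine (lintegral_congr_ae ?_).trans (lintegral_zero (μ := μ))
      filter_upwards [h0] with X hX
      simp [hX]
    rw [hf1] at h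
    exact one_ne_zero h
  have hae2 : ∀ᵐ X ∂μ, 0 < pfkReal v L 1 f X := by
    filter_upwards [ae_cellN_ae_periodicPathAction_lt_top hv hL hW 1] with X hX
    exact pfkReal_pos_of_ae_action_lt_top hv hL one_pos hX hfm hf0 hfper
      (by rw [hf2]; exact ENNReal.one_ne_top) hne
  filter_upwards [hae1, hae2] with X h1 h2
  rw [h1] at h2
  exact pos_of_mul_pos_right h2 hc.le


/-- **Positivity KEY for a general measurable integrable profile, unconditional** (the form upper bound is the
LANDED stub S-A `stub_fkFormUpperBoundIntegrable`). [cite: ReedSimonIV1978, §XIII.12 Thm XIII.44] -/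
theorem ae_pos_of_nonneg_minimiser {N : ℕ} (hN : 1 ≤ N) {L : ℝ} (hL : 0 < L) {v : ℝ → ℝ≥0∞} (hv : Measurable v)
    (hint : (∫⁻ x : Space, v ‖x‖) ≠ ⊤) (f : Config N → ℝ) (hfm : Measurable f) (hf0 : ∀ X, 0 ≤ f X)
    (hfper : ∀ (X : Config N) (i : Fin N) (k : Fin 3), f (X + Pi.single i (EuclideanSpace.single k L)) = f X)
    (hf1 : (∫⁻ X in cellN N L, ENNReal.ofReal (f X ^ 2)) = 1)
    (happrox : ∀ ε : ℝ, 0 < ε → ∃ φ : Config N → ℝ, ContDiff ℝ 1 φ ∧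
      (∀ (X : Config N) (i : Fin N) (k : Fin 3), φ (X + Pi.single i (EuclideanSpace.single k L)) = φ X) ∧
      (∫⁻ X in cellN N L, ENNReal.ofReal ((φ X - f X) ^ 2)) ≤ ENNReal.ofReal ε ∧
      (∫⁻ X in cellN N L, realKinetic φ X) +
          (∫⁻ X in cellN N L, ENNReal.ofReal (φ X ^ 2) * periodicInteraction v L X) ≤
        periodicGroundStateEnergy v N L + ENNReal.ofReal ε) :
    ∀ᵐ X ∂(volume.restrict (cellN N L)), 0 < f X :=
  ae_pos_of_nonneg_minimiser_of_integrable stub_fkFormUpperBoundIntegrable hN hL hv hint f hfm hf0 hfper hf1 happrox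

/-- **Registered sub-goal `stub_pfPositiveGeneral` of the crux item** (line `linear-ph-floor-wagner`, seat c2): `ae_pos_of_nonneg_minimiser`.
[cite: ReedSimonIV1978, §XIII.12 Thm XIII.44] -/
theorem stub_pfPositiveGeneral :
    ∀ {N : ℕ}, 1 ≤ N → ∀ {L : ℝ}, 0 < L → ∀ {v : ℝ → ℝ≥0∞}, Measurable v → (∫⁻ x : Space, v ‖x‖) ≠ ⊤ → ∀ f : Config N → ℝ, Measurable f → (∀ X, 0 ≤ f X) → (∀ (X : Config N) (i : Fin N) (k : Fin 3), f (X + Pi.single i (EuclideanSpace.single k L)) = f X) → (∫⁻ X in cellN N L, ENNReal.ofReal (f X ^ 2)) = 1 → (∀ ε : ℝ, 0 < ε → ∃ φ : Config N → ℝ, ContDiff ℝ 1 φ ∧ (∀ (X : Config N) (i : Fin N) (k : Fin 3), φ (X + Pi.single i (EuclideanSpace.single k L)) = φ X) ∧ (∫⁻ X in cellN N L, ENNReal.ofReal ((φ X - f X) ^ 2)) ≤ ENNReal.ofReal ε ∧ (∫⁻ X in cellN N L, realKinetic φ X) + (∫⁻ X in cellN N L, ENNReal.ofReal (φ X ^ 2)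 * periodicInteraction v L X) ≤ periodicGroundStateEnergy v N L + ENNReal.ofReal ε) → ∀ᵐ X ∂(volume.restrict (cellN N L)), 0 < f X :=
  fun hN _ hL _ hv hint f hfm hf0 hfper hf1 happrox =>
    ae_pos_of_nonneg_minimiser hN hL hv hint f hfm hf0 hfper hf1 happrox

end Summit.AtomisticToContinuum.BoseEinsteinCondensation.Cruxes.PeriodicIRBound.LinearPhFloorWagner

end
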